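import Literature.AlgebraicGeometry.Resolution.LogRegularCompletionSandwich
import HarnessLib

/-!
# Kato 1994, (10.3) for a non-complete base: the refined chart of a log regular local ring

`Literature/AlgebraicGeometry/Resolution/LogRegularRefinementLocal.lean`. K. Kato, *Toric
singularities*, Amer. J. Math. 116 (1994), (3.2) is a statement about the COMPLETION `𝒪̂_{X,x}`,
while (10.3) "`X′` is regular" concerns the local rings of `X′ = X ×_{ℤ[P]} ℤ[ℕ^N]` themselves.
`LogRegularRefinementRegular.lean` proves (10.3) at the closed point for a complete base; this
file removes the completeness assumption: for a Noetherian local ring `A` with chart `φ : P → A`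
(`φ(P ∖ 0)` generating `𝔪_A`, `dim A = rank P`) the local ring `B_𝔔` of the refined chart
`B = A[T]/(φ(p) − T^{c p})` at `𝔔 = (𝔪_A, T)` is regular of dimension `N`. The structure
theorem is applied to `Â` (Cohen coefficients `Λ → Â`), and the completion sandwich
(`LogRegularCompletionSandwich.lean`) is run for `S = B_𝔔` over the base `A`.

* `ringKrullDim_model_le_of_completion` — `dim Λ⟦T⟧/(c_*θ) ≤ dim B_𝔔` from the structure of `Â`;
* `isRegularLocalRing_localization_closedPoint_of_isNoetherianRing` — **(10.3) at the closed
  point, d = 0 normal form, arbitrary Noetherian local base.**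

References: [Kato1994] K. Kato, Toric singularities, Amer. J. Math. 116 (1994), (3.2), (10.3).
-/

noncomputable section

open IsLocalRing MvPowerSeries Literature.RingTheory.MvPowerSeries
  Literature.RingTheory.MvPowerSeries.monoidPowerSeries
  Literature.RingTheory.CompleteLocalRings

namespace Literature.AlgebraicGeometry.Resolution

namespace LogRegularCompleteStructure

universe u v

/-! ### The refined chart over a non-complete base -/

/-- `X^d = ∏ Xᵢ^{dᵢ}` in `Λ⟦T₁,…,T_N⟧`. [folklore] -/
private theorem monomial_one_eq_prod' {Λ : Type u} [CommRing Λ] {N : ℕ} (d : Fin N →₀ ℕ) :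
    MvPowerSeries.monomial d (1 : Λ) =
      d.prod fun i n => (MvPowerSeries.X i : MvPowerSeries (Fin N) Λ) ^ n := by
  classical
  have h := prod_pow_monomial (R := Λ) (fun i : Fin N => Finsupp.single i 1) d
  have hexp : expSum (fun i : Fin N => Finsupp.single i 1) d = d := by
    unfold expSum
    simp only [Finsupp.smul_single_one]
    exact d.sum_single
  rw [hexp] at h
  rw [← h]
  rfl

section Chart

variable {A : Type u} [CommRing A] [IsLocalRing A] [IsNoetherianRing A]
  {Λ : Type u} [CommRing Λ] [IsLocalRing Λ] [IsNoetherianRing Λ] [IsAdicComplete (maximalIdeal Λ) Λ]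
  {M N : ℕ} {P : AddSubmonoid (Fin M →₀ ℕ)}
  {φ : (Fin M →₀ ℕ) → A} {c : (Fin M →₀ ℕ) → (Fin N →₀ ℕ)}
  (hφ0 : φ 0 = 1) (hφm : ∀ p ∈ P, p ≠ 0 → φ p ∈ maximalIdeal A) (hc0 : c 0 = 0)
  (hc : ∀ p ∈ P, p ≠ 0 → c p ≠ 0)

set_option maxHeartbeats 800000 in
/-- **Kato (10.3) via (3.2), dimension part, non-complete base.** Let `A` be a Noetherian local
ring with chart `φ` (`φ(P ∖ 0)` generating `𝔪_A`), `Λ → Â` a local homomorphism from a complete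
Noetherian local ring inducing a surjection on residue fields, `ψ : Λ⟦P⟧ ↠ Â` the induced
surjection with `ker ψ = (θ)`, `c : P → ℕ^N` a refinement (`c⁻¹(0) = 0`, finite fibres). Then
`dim Λ⟦T⟧/(c_*θ) ≤ dim B_𝔔` for the refined chart `B` OVER `A` at its closed point.
[cite: Kato1994, (10.3)] -/
theorem ringKrullDim_model_le_of_completion
    (j : Λ →+* AdicCompletion (maximalIdeal A) A) [IsLocalHom j]
    (hres : ∀ a : AdicCompletion (maximalIdeal A) A, ∃ l : Λ,
      a - j l ∈ maximalIdeal (AdicCompletion (maximalIdeal A) A))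
    (hgen : maximalIdeal A ≤ Ideal.span (φ '' {p | p ∈ P ∧ p ≠ 0}))
    (hfin : ∀ e : Fin N →₀ ℕ, {p : Fin M →₀ ℕ | p ∈ P ∧ c p = e}.Finite)
    (hadd : ∀ a ∈ P, ∀ b ∈ P, c (a + b) = c a + c b)
    (ψ : monoidPowerSeries Λ P →+* AdicCompletion (maximalIdeal A) A)
    (hψsurj : Function.Surjective ψ)
    (hψmon : ∀ (p : Fin M →₀ ℕ) (hp : p ∈ P),
      ψ ⟨MvPowerSeries.monomial p (1 : Λ), monomial_mem hp 1⟩ = algebraMap A _ (φ p))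
    (hψC : ∀ l : Λ, ψ ⟨MvPowerSeries.C l, C_mem l⟩ = j l)
    (θ : monoidPowerSeries Λ P) (hker : RingHom.ker ψ = Ideal.span {θ})
    (hθm : MvPowerSeries.constantCoeff (θ : MvPowerSeries (Fin M) Λ) ∈ maximalIdeal Λ)
    (θ' : MvPowerSeries (Fin N) Λ)
    (hθ'def : (pushforward (R := Λ) c hfin hc0 hadd θ : MvPowerSeries (Fin N) Λ) = θ') :
    letI := isMaximal_closedPoint hφ0 hφm hc0 hc
    ringKrullDim (MvPowerSeries (Fin N) Λ ⧸ Ideal.span {θ'}) ≤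
      ringKrullDim (Localization.AtPrime (closedPoint φ c P hφ0 hφm hc0 hc)) := by
  classical
  letI := isMaximal_closedPoint hφ0 hφm hc0 hc
  -- the model `R' = Λ⟦T⟧/(θ')`: local, Noetherian, complete
  haveI hEnoeth : IsNoetherianRing (MvPowerSeries (Fin N) Λ) := isNoetherianRing_mvPowerSeries Λ (Fin N)
  haveI hEcomp : IsAdicComplete (maximalIdeal (MvPowerSeries (Fin N) Λ)) (MvPowerSeries (Fin N) Λ) :=
    Literature.NumberTheory.GaloisRepresentations.NearlyOrdinaryPresentationCA.isAdicComplete_maximalIdeal_mvPowerSeries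
      Λ N
  have hker0 : ∀ p ∈ P, c p = 0 → p = 0 := fun p hp h0 => by
    by_contra hne; exact hc p hp hne h0
  have hθ'm : θ' ∈ maximalIdeal (MvPowerSeries (Fin N) Λ) := by
    rw [mem_maximalIdeal, mem_nonunits_iff]
    intro hu
    have h := MvPowerSeries.isUnit_constantCoeff _ hu
    rw [← hθ'def, constantCoeff_pushforward c hfin hc0 hadd hker0 θ] at h
    exact ((mem_maximalIdeal _).1 hθm) h
  haveI hR'loc : IsLocalRing (MvPowerSeries (Fin N) Λ ⧸ Ideal.span {θ'}) :=
    isLocalRing_quotient (Ideal.span_singleton_ne_top hθ'm)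
  haveI hR'comp : IsAdicComplete (maximalIdeal (MvPowerSeries (Fin N) Λ ⧸ Ideal.span {θ'}))
      (MvPowerSeries (Fin N) Λ ⧸ Ideal.span {θ'}) := isAdicComplete_quotient _
  -- `ρ_Â : Â → R'` and `ρ_A = ρ_Â ∘ (A → Â)`
  let mk' : MvPowerSeries (Fin N) Λ →+* MvPowerSeries (Fin N) Λ ⧸ Ideal.span {θ'} :=
    Ideal.Quotient.mk (Ideal.span {θ'})
  have hkill : ∀ f ∈ RingHom.ker ψ,
      (mk'.comp (pushforward (R := Λ) c hfin hc0 hadd).toRingHom) f = 0 := by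
    intro f hf
    rw [hker, Ideal.mem_span_singleton] at hf
    obtain ⟨g, rfl⟩ := hf
    rw [RingHom.comp_apply, AlgHom.toRingHom_eq_coe, AlgHom.coe_toRingHom, map_mul,
      Ideal.Quotient.eq_zero_iff_mem, hθ'def]
    exact Ideal.mul_mem_right _ _ (Ideal.subset_span (Set.mem_singleton θ'))
  let e : (monoidPowerSeries Λ P ⧸ RingHom.ker ψ) ≃+* AdicCompletion (maximalIdeal A) A :=
    RingHom.quotientKerEquivOfSurjective hψsurj
  let ρh : AdicCompletion (maximalIdeal A) A →+* MvPowerSeries (Fin N) Λ ⧸ Ideal.span {θ'} :=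
    (Ideal.Quotient.lift (RingHom.ker ψ) (mk'.comp (pushforward (R := Λ) c hfin hc0 hadd).toRingHom)
      hkill).comp e.symm.toRingHom
  have hρh : ∀ f : monoidPowerSeries Λ P, ρh (ψ f) = mk' (pushforward (R := Λ) c hfin hc0 hadd f) := by
    intro f
    have he : e.symm (ψ f) = Ideal.Quotient.mk (RingHom.ker ψ) f := by
      rw [RingEquiv.symm_apply_eq]
      exact (RingHom.quotientKerEquivOfSurjective_apply_mk hψsurj f).symm
    show (Ideal.Quotient.lift (RingHom.ker ψ) _ hkill) (e.symm (ψ f)) = _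
    rw [he, Ideal.Quotient.lift_mk]
    rfl
  let ρA : A →+* MvPowerSeries (Fin N) Λ ⧸ Ideal.span {θ'} :=
    ρh.comp (algebraMap A (AdicCompletion (maximalIdeal A) A))
  let t : Fin N → MvPowerSeries (Fin N) Λ ⧸ Ideal.span {θ'} := fun i => mk' (MvPowerSeries.X i)
  have htm : ∀ i, t i ∈ maximalIdeal (MvPowerSeries (Fin N) Λ ⧸ Ideal.span {θ'}) := by
    intro i
    rw [← IsLocalRing.map_maximalIdeal_of_surjective mk' Ideal.Quotient.mk_surjective]
    refine Ideal.mem_map_of_mem _ ((mem_maximalIdeal _).2 (mem_nonunits_iff.2 fun hu => ?_))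
    have h := MvPowerSeries.isUnit_constantCoeff _ hu
    rw [MvPowerSeries.constantCoeff_X] at h
    exact not_isUnit_zero h
  have hρAφ : ∀ p ∈ P, ρA (φ p) = (c p).prod fun i n => t i ^ n := by
    intro p hp
    show ρh (algebraMap A _ (φ p)) = _
    rw [← hψmon p hp, hρh, pushforward_monomial c hfin hc0 hadd hp 1, monomial_one_eq_prod',
      map_finsuppProd]
    simp only [map_pow, t]
  -- `ρ_S : S → R'`, `A → S`, generators, residue approximation
  let ρS : Localization.AtPrime (closedPoint φ c P hφ0 hφm hc0 hc) →+*
      MvPowerSeries (Fin N) Λ ⧸ Ideal.span {θ'} :=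
    liftLocalization hφ0 hφm hc0 hc ρA t hρAφ htm hgen
  have hmapS : (maximalIdeal (Localization.AtPrime (closedPoint φ c P hφ0 hφm hc0 hc))).map ρS ≤
      maximalIdeal (MvPowerSeries (Fin N) Λ ⧸ Ideal.span {θ'}) :=
    map_maximalIdeal_liftLocalization_le hφ0 hφm hc0 hc ρA t hρAφ htm hgen
  let ιS : RefinementRing φ c P →+* Localization.AtPrime (closedPoint φ c P hφ0 hφm hc0 hc) :=
    algebraMap (RefinementRing φ c P) (Localization.AtPrime (closedPoint φ c P hφ0 hφm hc0 hc))
  have hιmem : ∀ b ∈ closedPoint φ c P hφ0 hφm hc0 hc,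
      ιS b ∈ maximalIdeal (Localization.AtPrime (closedPoint φ c P hφ0 hφm hc0 hc)) := by
    intro b hb
    rw [← Localization.AtPrime.map_eq_maximalIdeal]
    exact Ideal.mem_map_of_mem _ hb
  let aS : A →+* Localization.AtPrime (closedPoint φ c P hφ0 hφm hc0 hc) :=
    ιS.comp ((Ideal.Quotient.mk (refinementIdeal φ c P)).comp MvPolynomial.C)
  have haS : ∀ a, aS a = ιS (Ideal.Quotient.mk _ (MvPolynomial.C a)) := fun a => rfl
  have haSm : (maximalIdeal A).map aS ≤
      maximalIdeal (Localization.AtPrime (closedPoint φ c P hφ0 hφm hc0 hc)) := by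
    rw [Ideal.map_le_iff_le_comap]
    intro a ha
    rw [Ideal.mem_comap, haS]
    exact hιmem _ (mk_C_mem_closedPoint hφ0 hφm hc0 hc ha)
  have hresS : ∀ s, ∃ a : A, s - aS a ∈
      maximalIdeal (Localization.AtPrime (closedPoint φ c P hφ0 hφm hc0 hc)) :=
    fun s => exists_sub_algebraMap_C_mem hφ0 hφm hc0 hc s
  let x : Fin N → Localization.AtPrime (closedPoint φ c P hφ0 hφm hc0 hc) :=
    fun i => ιS (Ideal.Quotient.mk _ (MvPolynomial.X i))
  have hx : maximalIdeal (Localization.AtPrime (closedPoint φ c P hφ0 hφm hc0 hc)) =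
      Ideal.span (Set.range x) := by
    rw [← Localization.AtPrime.map_eq_maximalIdeal]
    have h1 := congrArg (Ideal.map ιS) (closedPoint_eq_span_X hφ0 hφm hc0 hc hgen)
    rw [h1, Ideal.map_span, ← Set.range_comp]
    rfl
  have hcomp : ρS.comp aS = ρh.comp (algebraMap A (AdicCompletion (maximalIdeal A) A)) := by
    refine RingHom.ext fun a => ?_
    show liftLocalization hφ0 hφm hc0 hc ρA t hρAφ htm hgen (ιS _) = ρA a
    rw [liftLocalization_algebraMap, lift_mk_C]
  have hρh_max : (maximalIdeal (AdicCompletion (maximalIdeal A) A)).map ρh ≤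
      maximalIdeal (MvPowerSeries (Fin N) Λ ⧸ Ideal.span {θ'}) := by
    rw [AdicCompletion.maximalIdeal_eq_map, Ideal.map_map, ← hcomp, ← Ideal.map_map]
    exact le_trans (Ideal.map_mono haSm) hmapS
  have hqX : ∀ i, mk' (MvPowerSeries.X i) = ρS (x i) := by
    intro i
    show t i = liftLocalization hφ0 hφm hc0 hc ρA t hρAφ htm hgen (algebraMap _ _ _)
    rw [liftLocalization_algebraMap, lift_mk_X]
  have hqC : ∀ l, mk' (MvPowerSeries.C l) = ρh (j l) := by
    intro l
    rw [← hψC, hρh]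
    congr 1
    exact ((pushforward (R := Λ) c hfin hc0 hadd).commutes l).symm
  -- (stepwise application: a one-shot `exact` makes the elaborator compare instance paths on
  -- `Localization.AtPrime` and time out)
  have H := @ringKrullDim_le_of_sandwich_over_base A _ _ _ Λ _ _ _
    (Localization.AtPrime (closedPoint φ c P hφ0 hφm hc0 hc)) _ _ _
    (MvPowerSeries (Fin N) Λ ⧸ Ideal.span {θ'}) _ _ _ _ N j _ hres aS haSm hresS x hx ρh hρh_max
    ρS hmapS hcomp mk' Ideal.Quotient.mk_surjective hqX hqC
  exact H

/-- **Kato 1994, Thm. (10.3) at the closed point (d = 0 normal form), arbitrary Noetherian local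
base.** Let `A` be a Noetherian local ring with a chart `φ : P → A` by a finitely generated
monoid `P ⊆ ℕ^{(M)}` with `φ(P ∖ 0) ⊆ 𝔪_A` generating `𝔪_A` and `dim A = rank P`, and let
`c : P → ℕ^N` be additive with `c⁻¹(0) = 0` and finite fibres. Then the local ring of
`B = A[T₁,…,T_N]/(φ(p) − T^{c p})` at `𝔔 = (𝔪_A, T)` is regular of dimension `N`.
[cite: Kato1994, (10.3)] -/
theorem isRegularLocalRing_localization_closedPoint_of_isNoetherianRing (hP : P.FG)
    (hφadd : ∀ a ∈ P, ∀ b ∈ P, φ (a + b) = φ a * φ b)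
    (hgen : maximalIdeal A ≤ Ideal.span (φ '' {p | p ∈ P ∧ p ≠ 0}))
    (hdim : ringKrullDim A = rank P)
    (hadd : ∀ a ∈ P, ∀ b ∈ P, c (a + b) = c a + c b)
    (hfin : ∀ e : Fin N →₀ ℕ, {p : Fin M →₀ ℕ | p ∈ P ∧ c p = e}.Finite) :
    letI := isMaximal_closedPoint hφ0 hφm hc0 hc
    IsRegularLocalRing (Localization.AtPrime (closedPoint φ c P hφ0 hφm hc0 hc)) ∧
      ringKrullDim (Localization.AtPrime (closedPoint φ c P hφ0 hφm hc0 hc)) = N := by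
  classical
  letI := isMaximal_closedPoint hφ0 hφm hc0 hc
  haveI : IsNoetherianRing (AdicCompletion (maximalIdeal A) A) :=
    isNoetherianRing_adicCompletion_maximalIdeal A
  have hker0 : ∀ p ∈ P, c p = 0 → p = 0 := fun p hp h0 => by
    by_contra hne; exact hc p hp hne h0
  -- the chart of `Â`
  let φh : (Fin M →₀ ℕ) → AdicCompletion (maximalIdeal A) A := fun p => algebraMap A _ (φ p)
  have hφh0 : φh 0 = 1 := by simp only [φh, hφ0, map_one]
  have hφhadd : ∀ a ∈ P, ∀ b ∈ P, φh (a + b) = φh a * φh b := by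
    intro a ha b hb; simp only [φh, hφadd a ha b hb, map_mul]
  have hφhm : ∀ p ∈ P, p ≠ 0 → φh p ∈ maximalIdeal (AdicCompletion (maximalIdeal A) A) := by
    intro p hp hp0
    rw [AdicCompletion.maximalIdeal_eq_map]
    exact Ideal.mem_map_of_mem _ (hφm p hp hp0)
  have hgenh : maximalIdeal (AdicCompletion (maximalIdeal A) A) ≤
      Ideal.span (φh '' {p | p ∈ P ∧ p ≠ 0}) := by
    rw [AdicCompletion.maximalIdeal_eq_map]
    refine (Ideal.map_mono hgen).trans ?_
    rw [Ideal.map_span, ← Set.image_comp]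
    rfl
  have hdimh : ringKrullDim (AdicCompletion (maximalIdeal A) A) = rank P := by
    rw [ringKrullDim_adicCompletion A, hdim]
  -- dimension `≥ N` by the sandwich, in either characteristic
  have hN : (N : WithBot ℕ∞) ≤
      ringKrullDim (Localization.AtPrime (closedPoint φ c P hφ0 hφm hc0 hc)) := by
    obtain ⟨p, hp⟩ := CharP.exists (ResidueField (AdicCompletion (maximalIdeal A) A))
    rcases CharP.char_is_prime_or_zero (ResidueField (AdicCompletion (maximalIdeal A) A)) p with
      hprime | rfl
    · haveI : Fact p.Prime := ⟨hprime⟩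
      obtain ⟨R, _, _, _, hRN, hRc, hmax, hp0, j, hres⟩ :=
        exists_cohenDVR_ringHom (AdicCompletion (maximalIdeal A) A) p
      haveI := hRN
      haveI := hRc
      have hpA : (p : AdicCompletion (maximalIdeal A) A) ∈
          maximalIdeal (AdicCompletion (maximalIdeal A) A) := by
        rw [← residue_eq_zero_iff, map_natCast]
        exact CharP.cast_eq_zero _ p
      haveI : IsLocalHom j := by
        refine ⟨fun r hr => ?_⟩
        by_contra hrn
        have hrm : r ∈ maximalIdeal R := (mem_maximalIdeal _).2 (mem_nonunits_iff.2 hrn)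
        rw [hmax, Ideal.mem_span_singleton] at hrm
        obtain ⟨s, rfl⟩ := hrm
        rw [map_mul, map_natCast] at hr
        exact ((mem_maximalIdeal _).1 (Ideal.mul_mem_right _ _ hpA)) hr
      obtain ⟨ψ, hψsurj, hψmon, hψC⟩ :=
        exists_lift_surjective j hres hP φh hφh0 hφhadd hφhm hgenh
      have hjp : j (p : R) ∈ maximalIdeal _ := by rw [map_natCast]; exact hpA
      obtain ⟨θ, hθ, hθπ⟩ := exists_theta ψ hψsurj j hψC φh hψmon hgenh (p : R) hjp
      have hker := ker_eq_span_theta hp0 hmax hP ψ hψsurj hdimh θ hθ hθπ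
      have hθm : MvPowerSeries.constantCoeff (θ : MvPowerSeries (Fin M) R) ∈ maximalIdeal R := by
        rw [hθπ, hmax]; exact Ideal.subset_span rfl
      have hθ' : MvPowerSeries.constantCoeff
          (pushforward (R := R) c hfin hc0 hadd θ : MvPowerSeries (Fin N) R) = (p : R) := by
        rw [constantCoeff_pushforward c hfin hc0 hadd hker0, hθπ]
      rw [← (isRegularLocalRing_model_dvr hp0 hmax _ hθ').2]
      exact ringKrullDim_model_le_of_completion hφ0 hφm hc0 hc j hres hgen hfin hadd ψ hψsurj
        hψmon hψC θ hker hθm _ rfl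
    · haveI : CharZero (ResidueField (AdicCompletion (maximalIdeal A) A)) :=
        CharP.charP_to_charZero _
      obtain ⟨σ, hσ⟩ := exists_coefficientField_of_charZero (AdicCompletion (maximalIdeal A) A)
      have hbot : maximalIdeal (ResidueField (AdicCompletion (maximalIdeal A) A)) = ⊥ :=
        (IsLocalRing.isField_iff_maximalIdeal_eq).1 (Field.toIsField _)
      haveI : IsAdicComplete (maximalIdeal (ResidueField (AdicCompletion (maximalIdeal A) A)))
          (ResidueField (AdicCompletion (maximalIdeal A) A)) := by
        rw [hbot]; infer_instance
      haveI : IsLocalHom σ := by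
        refine ⟨fun x hx => ?_⟩
        by_contra hxn
        have hx0 : x = 0 := by
          by_contra h
          exact hxn (Ne.isUnit h)
        rw [hx0, map_zero] at hx
        exact not_isUnit_zero hx
      have hres : ∀ a : AdicCompletion (maximalIdeal A) A, ∃ l, a - σ l ∈ maximalIdeal _ :=
        fun a => ⟨residue _ a, by rw [← residue_eq_zero_iff, map_sub, hσ, sub_self]⟩
      obtain ⟨ψ, hψsurj, hψmon, hψC⟩ :=
        exists_lift_surjective σ hres hP φh hφh0 hφhadd hφhm hgenh
      have hker : RingHom.ker ψ =
          Ideal.span {(0 : monoidPowerSeries (ResidueField (AdicCompletion (maximalIdeal A) A)) P)} := by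
        rw [ker_eq_bot_of_field hP ψ hψsurj hdimh, eq_comm, Ideal.span_singleton_eq_bot]
      have hθm : MvPowerSeries.constantCoeff
          ((0 : monoidPowerSeries (ResidueField (AdicCompletion (maximalIdeal A) A)) P) :
            MvPowerSeries (Fin M) (ResidueField (AdicCompletion (maximalIdeal A) A))) ∈
          maximalIdeal (ResidueField (AdicCompletion (maximalIdeal A) A)) := by
        rw [Subalgebra.coe_zero, map_zero]; exact Ideal.zero_mem _
      have hmodel : ringKrullDim (MvPowerSeries (Fin N) (ResidueField (AdicCompletion (maximalIdeal A) A)) ⧸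
          Ideal.span {(0 : MvPowerSeries (Fin N) (ResidueField (AdicCompletion (maximalIdeal A) A)))}) = N := by
        rw [ringKrullDim_eq_of_ringEquiv ((Ideal.quotEquivOfEq
          ((Ideal.span_singleton_eq_bot).2 rfl)).trans (RingEquiv.quotientBot _))]
        exact (isRegularLocalRing_model_field _ N).2
      rw [← hmodel]
      exact ringKrullDim_model_le_of_completion hφ0 hφm hc0 hc σ hres hgen hfin hadd ψ hψsurj
        hψmon hψC 0 hker hθm _ (by rw [map_zero])
  have hemb := spanFinrank_maximalIdeal_localization_le hφ0 hφm hc0 hc hgen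
  have hemb' : ((maximalIdeal (Localization.AtPrime (closedPoint φ c P hφ0 hφm hc0 hc))).spanFinrank
      : WithBot ℕ∞) ≤ N := by exact_mod_cast hemb
  have hle := ringKrullDim_le_spanFinrank_maximalIdeal
    (Localization.AtPrime (closedPoint φ c P hφ0 hφm hc0 hc))
  exact ⟨IsRegularLocalRing.of_spanFinrank_maximalIdeal_le _ (hemb'.trans hN),
    le_antisymm (hle.trans hemb') hN⟩

end Chart

end LogRegularCompleteStructure

end Literature.AlgebraicGeometry.Resolution
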